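import Literature.NumberTheory.EllipticCurves.Aoki1999.CongruentTwoSelmerClosedFormula
import Literature.NumberTheory.EllipticCurves.HeathBrown1994.CongruentTwoSelmerMonskyMatrix
import Summits.BirchSwinnertonDyer.Rank1Residual.P2.CongruentNumberSilentEvenFiveAokiSymbols
import Mathlib.NumberTheory.LegendreSymbol.JacobiSymbol
import HarnessLib

/-!
# Cell `bsd-monsky`: AOKI = MONSKY FOR EVERY NUMBER OF PRIME FACTORS — part 3, the dictionary (i):
# Aoki's Hilbert-symbol bits `λ_ℓ(x)` on `n = 2p₁⋯p_k` (nothing arithmetic asserted)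

HONEST FRAMING (cell `bsd-monsky`, run/shared/lean/pub/bsd-monsky/, README §1: ONE theorem on ONE explicit
infinite family of quadratic twists of the congruent number curve at the prime `2`; not "BSD for rank ≤ 1",
nothing at odd primes, nothing booked until the cross-family referee passes the written proof). This file
asserts NO arithmetic fact and carries NO named-fact binder: it EVALUATES the computable symbols of Aoki 1999
Thm 2.2 (`Literature…Aoki1999.lam`: `λ_ℓ(x) = {−n, x}_ℓ`, `λ₂(x) = {2, x}_2`) on a general even square-free
`n = 2p₁⋯p_k` (`p : Fin k → ℕ` injective, odd primes) in terms of Monsky's additive Legendre symbols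
(`Literature…HeathBrown1994.addLegendreSym`), through Serre's explicit local signs (`localSign`, = the Hilbert
symbol of `ℚ_ℓ` on integers by `hilbertSymbol_padic_intCast`):

* §0 signs ↔ bits (`{a, bc} = {a, b} + {a, c}` over finite products; a product of signs is `−1` iff the
  sum of the bits is `1`);
* §1 `λ_{p_j}(p_i) = [(p_i/p_j) = −1]` (`i ≠ j`), `λ_{p_j}(2) = [(2/p_j) = −1]`, `λ₂(p_i) = [(2/p_i) = −1]`,
  and on the diagonal `λ_{p_j}(p_j) = [(2/p_j) = −1] + Σ_{i ≠ j} [(p_i/p_j) = −1]` (the bit of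
  `((n/p_j)/p_j)`): i.e. `λ_{p_j}(p_i)` is the `(i, j)` entry of `L = Aᵀ + D_t` (`A` = Monsky's matrix) —
  part (ii) (`…EvenAokiMonskyShape.lean`) and the main theorem (`…EvenAokiMonskyAllPrimes.lean`) use this.

References: [Aoki1999] §2 pp. 79–81; [HeathBrown1994SelmerCongruentII] Appendix (Monsky), typescript p. 39
L10–L26, p. 41 L20–L36; [Serre1973] Ch. III §1.2 Thms. 1–2; [IrelandRosen1990] Ch. 5 §2.
-/

noncomputable section

open scoped Classical

open Matrix WeierstrassCurve Literature.NumberTheory.EllipticCurves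
  Literature.NumberTheory.EllipticCurves.Aoki1999
  Literature.NumberTheory.EllipticCurves.HeathBrown1994
  Literature.NumberTheory.EllipticCurves.HeathBrown1994.Families
  Literature.NumberTheory.QuadraticForms

set_option autoImplicit false

namespace Summit.BirchSwinnertonDyer.Rank1Residual.P2.AokiMonsky

/-! ## §0 Signs and bits -/

section Bits

/-- A bit from a sign: the additive symbol of a product of two signs is the sum of the bits. [folklore] -/
theorem ite_mul_sign_eq_add {s₁ s₂ : ℤ} (h₁ : s₁ = 1 ∨ s₁ = -1) (h₂ : s₂ = 1 ∨ s₂ = -1) :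
    (if s₁ * s₂ = 1 then (0 : ZMod 2) else 1) =
      (if s₁ = 1 then (0 : ZMod 2) else 1) + (if s₂ = 1 then (0 : ZMod 2) else 1) := by
  rcases h₁ with rfl | rfl <;> rcases h₂ with rfl | rfl <;> decide

/-- The product of signs is `1` or `−1` according as the sum of their bits is `0` or not. [folklore] -/
theorem prod_sign_eq_ite_sum_bits {α : Type*} (s : Finset α) (f : α → ℤ)
    (hf : ∀ a ∈ s, f a = 1 ∨ f a = -1) :
    ∏ a ∈ s, f a = if (∑ a ∈ s, (if f a = 1 then (0 : ZMod 2) else 1)) = 0 then 1 else -1 := by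
  induction s using Finset.induction_on with
  | empty => simp
  | insert a s ha ih =>
    rw [Finset.prod_insert ha, Finset.sum_insert ha,
      ih fun b hb => hf b (Finset.mem_insert_of_mem hb)]
    have h01 : ∀ x : ZMod 2, x = 0 ∨ x = 1 := by decide
    rcases hf a (Finset.mem_insert_self a s) with h | h
    · rcases h01 (∑ a ∈ s, if f a = 1 then (0 : ZMod 2) else 1) with hs | hs
      · simp [h, hs]
      · simp [h, hs]
    · rcases h01 (∑ a ∈ s, if f a = 1 then (0 : ZMod 2) else 1) with hs | hs
      · simp [h, hs]
      · rw [h, hs]; decide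

variable {ℓ : ℕ} [hℓ : Fact ℓ.Prime]

/-- The additive Hilbert symbol is symmetric (non-zero integers). [cite: Serre1973, Ch. III §1.2 Thm. 2] -/
theorem hilbertBit_comm {a b : ℤ} (ha : a ≠ 0) (hb : b ≠ 0) : hilbertBit ℓ a b = hilbertBit ℓ b a := by
  rw [hilbertBit_eq_of_localSign ha hb, hilbertBit_eq_of_localSign hb ha, localSign_comm]

/-- The additive Hilbert symbol of a finite product in the second variable is the sum of the symbols.
[cite: Serre1973, Ch. III §1.2 Thm. 2] -/
theorem hilbertBit_finset_prod_right {α : Type*} {a : ℤ} (ha : a ≠ 0) (s : Finset α) (f : α → ℤ)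
    (hf : ∀ i ∈ s, f i ≠ 0) : hilbertBit ℓ a (∏ i ∈ s, f i) = ∑ i ∈ s, hilbertBit ℓ a (f i) := by
  induction s using Finset.induction_on with
  | empty => simp [hilbertBit_one_right]
  | insert b s hb ih =>
    have hf' : ∀ i ∈ s, f i ≠ 0 := fun i hi => hf i (Finset.mem_insert_of_mem hi)
    rw [Finset.prod_insert hb, Finset.sum_insert hb,
      hilbertBit_mul_right ha (hf b (Finset.mem_insert_self b s)) (Finset.prod_ne_zero_iff.mpr hf'),
      ih hf']

/-- From a sign to a bit: if `(a, b)_ℓ = (c/q)` then `{a, b}_ℓ` is Monsky's additive symbol of `(c/q)`.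
[cite: Serre1973, Ch. III §1.2 Thm. 1] -/
theorem hilbertBit_eq_addLegendreSym {a b c : ℤ} {q : ℕ} (ha : a ≠ 0) (hb : b ≠ 0)
    (h : localSign ℓ a b = jacobiSym c q) : hilbertBit ℓ a b = addLegendreSym c q := by
  rw [hilbertBit_eq_of_localSign ha hb, h, addLegendreSym_def]

end Bits

/-! ## §1 Aoki's symbols `λ_ℓ(x)` on `n = 2p₁⋯p_k` -/

section Symbols

variable {k : ℕ} (p : Fin k → ℕ)

/-- `∏ pᵢ = p_j · ∏_{i ≠ j} pᵢ` in `ℤ`. [folklore] -/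
theorem prod_cast_eq_mul_prod_erase (j : Fin k) :
    (∏ i, (p i : ℤ)) = (p j : ℤ) * ∏ i ∈ Finset.univ.erase j, (p i : ℤ) :=
  (Finset.mul_prod_erase Finset.univ (fun i => (p i : ℤ)) (Finset.mem_univ j)).symm

/-- `−n = p_j · m_j` with `m_j = −2 ∏_{i ≠ j} pᵢ`, for `n = 2p₁⋯p_k`. [folklore] -/
theorem neg_cast_two_mul_prod_eq (j : Fin k) :
    -((2 * ∏ i, p i : ℕ) : ℤ) = (p j : ℤ) * (-(2 * ∏ i ∈ Finset.univ.erase j, (p i : ℤ))) := by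
  push_cast
  rw [prod_cast_eq_mul_prod_erase p j]
  ring

variable (hp : ∀ i, (p i).Prime) (hodd : ∀ i, Odd (p i)) (hinj : Function.Injective p)

include hp in
/-- `2 ∏ pᵢ ≠ 0` in `ℤ` (with the minus sign). [folklore] -/
theorem neg_cast_two_mul_prod_ne_zero : -((2 * ∏ i, p i : ℕ) : ℤ) ≠ 0 := by
  have h : (2 * ∏ i, p i : ℕ) ≠ 0 :=
    mul_ne_zero two_ne_zero (Finset.prod_ne_zero_iff.mpr fun i _ => (hp i).ne_zero)
  exact neg_ne_zero.mpr (by exact_mod_cast h)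

include hp in
/-- The cofactor `m_j = −2 ∏_{i ≠ j} pᵢ ≠ 0`. [folklore] -/
theorem cofactor_ne_zero (j : Fin k) : -(2 * ∏ i ∈ Finset.univ.erase j, (p i : ℤ)) ≠ 0 :=
  neg_ne_zero.mpr (mul_ne_zero two_ne_zero
    (Finset.prod_ne_zero_iff.mpr fun i _ => by exact_mod_cast (hp i).ne_zero))

include hodd in
/-- `p_j ≠ 2`. [folklore] -/
theorem prime_ne_two (j : Fin k) : p j ≠ 2 := fun h => by
  have := hodd j; rw [h] at this; exact (Nat.not_odd_iff_even.mpr even_two) this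

include hp hodd hinj in
/-- `p_j ∤ m_j = −2 ∏_{i ≠ j} pᵢ` (distinct odd primes). [folklore] -/
theorem not_dvd_cofactor (j : Fin k) :
    ¬ (p j : ℤ) ∣ -(2 * ∏ i ∈ Finset.univ.erase j, (p i : ℤ)) := by
  intro h
  rw [dvd_neg] at h
  have hpr : Prime (p j : ℤ) := Nat.prime_iff_prime_int.mp (hp j)
  rcases hpr.dvd_mul.mp h with h2 | h2
  · exact not_dvd_two_of_prime_ne_two (hp j) (prime_ne_two p hodd j) h2
  · obtain ⟨i, hi, hdi⟩ := (Prime.dvd_finsetProd_iff hpr _).mp h2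
    have hij : p j = p i :=
      (Nat.prime_dvd_prime_iff_eq (hp j) (hp i)).mp (by exact_mod_cast hdi)
    exact (Finset.mem_erase.mp hi).1 (hinj hij).symm

include hp hinj in
/-- `p_j ∤ p_i` for `i ≠ j`. [folklore] -/
theorem not_dvd_prime_of_ne {i j : Fin k} (hij : i ≠ j) : ¬ (p j : ℤ) ∣ (p i : ℤ) :=
  not_dvd_of_ne (hp j) (hp i) fun h => hij (hinj h).symm

include hp hinj in
/-- `(p_i/p_j) = ±1` for `i ≠ j`. [cite: IrelandRosen1990, Ch. 5 §2 Prop. 5.2.2] -/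
theorem jacobiSym_prime_prime_eq_one_or {i j : Fin k} (hij : i ≠ j) :
    jacobiSym (p i) (p j) = 1 ∨ jacobiSym (p i) (p j) = -1 :=
  jacobiSym.eq_one_or_neg_one (by
    rw [Int.gcd_natCast_natCast]
    exact (Nat.coprime_primes (hp i) (hp j)).mpr fun h => hij (hinj h))

include hp hodd hinj in
/-- **`λ_{p_j}(p_i) = [(p_i/p_j) = −1]` for `i ≠ j`**: `(−n, p_i)_{p_j} = (p_j, p_i)_{p_j}(m_j, p_i)_{p_j} = (p_i/p_j)`.
[cite: Aoki1999, §2 p. 79] [cite: Serre1973, Ch. III §1.2 Thm. 1] -/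
theorem lam_prime_prime_of_ne {i j : Fin k} (hij : i ≠ j) :
    lam (2 * ∏ i, p i) (p j) (p i) = addLegendreSym (p i) (p j) := by
  haveI : Fact (p j).Prime := ⟨hp j⟩
  have h2 : p j ≠ 2 := prime_ne_two p hodd j
  rw [lam_of_ne_two (hp j) h2]
  refine hilbertBit_eq_addLegendreSym (neg_cast_two_mul_prod_ne_zero p hp)
    (by exact_mod_cast (hp i).ne_zero) ?_
  rw [neg_cast_two_mul_prod_eq p j,
    localSign_mul_left (p j) (by exact_mod_cast (hp j).ne_zero) (cofactor_ne_zero p hp j)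
      (by exact_mod_cast (hp i).ne_zero),
    localSign_comm (p j) (p j), localSign_odd_unit_prime h2 (not_dvd_prime_of_ne p hp hinj hij),
    localSign_odd_unit_unit h2 (not_dvd_cofactor p hp hodd hinj j) (not_dvd_prime_of_ne p hp hinj hij),
    mul_one, jacobiSym.legendreSym.to_jacobiSym]

include hp hodd hinj in
/-- **`λ_{p_j}(2) = [(2/p_j) = −1] = t_j`**: `(−n, 2)_{p_j} = (p_j, 2)_{p_j}(m_j, 2)_{p_j} = (2/p_j)`.
[cite: Aoki1999, §2 p. 79] [cite: Serre1973, Ch. III §1.2 Thm. 1] -/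
theorem lam_prime_two (j : Fin k) : lam (2 * ∏ i, p i) (p j) 2 = addLegendreSym 2 (p j) := by
  haveI : Fact (p j).Prime := ⟨hp j⟩
  have h2 : p j ≠ 2 := prime_ne_two p hodd j
  have hn2 : ¬ (p j : ℤ) ∣ 2 := not_dvd_two_of_prime_ne_two (hp j) h2
  rw [lam_of_ne_two (hp j) h2]
  refine hilbertBit_eq_addLegendreSym (neg_cast_two_mul_prod_ne_zero p hp) two_ne_zero ?_
  rw [neg_cast_two_mul_prod_eq p j,
    localSign_mul_left (p j) (by exact_mod_cast (hp j).ne_zero) (cofactor_ne_zero p hp j) two_ne_zero,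
    localSign_comm (p j) (p j), localSign_odd_unit_prime h2 hn2,
    localSign_odd_unit_unit h2 (not_dvd_cofactor p hp hodd hinj j) hn2, mul_one,
    jacobiSym.legendreSym.to_jacobiSym]

include hp hodd in
/-- **`λ₂(p_i) = [(2/p_i) = −1] = t_i`**: `(2, p_i)_2 = χ₈(p_i)`. [cite: Aoki1999, §2 p. 79]
[cite: Serre1973, Ch. III §1.2 Thm. 1] -/
theorem lam_two_prime (n : ℕ) (i : Fin k) : lam n 2 (p i) = addLegendreSym 2 (p i) := by
  rw [lam_two]
  exact hilbertBit_eq_addLegendreSym two_ne_zero (by exact_mod_cast (hp i).ne_zero)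
    (localSign_two_two_odd (hp i) (prime_ne_two p hodd i))

include hp hodd hinj in
/-- **`λ_{p_j}(p_j) = t_j + Σ_{i ≠ j} [(p_i/p_j) = −1]`** (the bit of `((n/p_j)/p_j) = (2/p_j)∏_{i≠j}(p_i/p_j)`):
`{−n, p_j} = {p_j, −1} + {p_j, 2} + Σ_i {p_j, p_i}` with `{p_j, −1} = {p_j, p_j} = [p_j ≡ 3 (4)]` cancelling.
[cite: Aoki1999, §2 p. 79] [cite: Serre1973, Ch. III §1.2 Thms. 1–2] -/
theorem lam_prime_self (j : Fin k) :
    lam (2 * ∏ i, p i) (p j) (p j) =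
      addLegendreSym 2 (p j) + ∑ i ∈ Finset.univ.erase j, addLegendreSym (p i) (p j) := by
  haveI : Fact (p j).Prime := ⟨hp j⟩
  have h2 : p j ≠ 2 := prime_ne_two p hodd j
  have hpj0 : (p j : ℤ) ≠ 0 := by exact_mod_cast (hp j).ne_zero
  have hP0 : ∀ i ∈ (Finset.univ : Finset (Fin k)), (p i : ℤ) ≠ 0 := fun i _ => by
    exact_mod_cast (hp i).ne_zero
  have hodd' : Odd (p j) := hodd j
  have hn1 : ¬ (p j : ℤ) ∣ -1 := by
    rw [dvd_neg, Int.natCast_dvd_ofNat]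
    exact fun h => (hp j).one_lt.ne' (Nat.dvd_one.mp h)
  rw [lam_of_ne_two (hp j) h2, hilbertBit_comm (neg_cast_two_mul_prod_ne_zero p hp) hpj0,
    show -((2 * ∏ i, p i : ℕ) : ℤ) = (-1) * (2 * ∏ i, (p i : ℤ)) by push_cast; ring,
    hilbertBit_mul_right hpj0 (by norm_num)
      (mul_ne_zero two_ne_zero (Finset.prod_ne_zero_iff.mpr hP0)),
    hilbertBit_mul_right hpj0 two_ne_zero (Finset.prod_ne_zero_iff.mpr hP0),
    hilbertBit_finset_prod_right hpj0 _ _ hP0, ← Finset.add_sum_erase _ _ (Finset.mem_univ j)]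
  -- the four kinds of symbols
  have e1 : hilbertBit (p j) (p j) (-1) = addLegendreSym (-1) (p j) := by
    refine hilbertBit_eq_addLegendreSym hpj0 (by norm_num) ?_
    rw [localSign_comm, localSign_odd_unit_prime h2 hn1, jacobiSym.legendreSym.to_jacobiSym]
  have e2 : hilbertBit (p j) (p j) 2 = addLegendreSym 2 (p j) := by
    refine hilbertBit_eq_addLegendreSym hpj0 two_ne_zero ?_
    rw [localSign_comm, localSign_odd_unit_prime h2 (not_dvd_two_of_prime_ne_two (hp j) h2),
      jacobiSym.legendreSym.to_jacobiSym]
  have e3 : hilbertBit (p j) (p j) (p j) = addLegendreSym (-1) (p j) := by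
    refine hilbertBit_eq_addLegendreSym hpj0 hpj0 ?_
    unfold localSign
    rw [if_neg h2, localSignOdd_self_self, jacobiSym.at_neg_one hodd']
  have e4 : ∀ i ∈ Finset.univ.erase j, hilbertBit (p j) (p j) (p i) = addLegendreSym (p i) (p j) := by
    intro i hi
    have hij : i ≠ j := (Finset.mem_erase.mp hi).1
    refine hilbertBit_eq_addLegendreSym hpj0 (by exact_mod_cast (hp i).ne_zero) ?_
    rw [localSign_comm, localSign_odd_unit_prime h2 (not_dvd_prime_of_ne p hp hinj hij),
      jacobiSym.legendreSym.to_jacobiSym]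
  rw [e1, e2, e3, Finset.sum_congr rfl e4]
  have : ∀ x y z : ZMod 2, x + (y + (x + z)) = y + z := by decide
  exact this _ _ _

end Symbols

end Summit.BirchSwinnertonDyer.Rank1Residual.P2.AokiMonsky

end
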